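import Summits.ValiantsHypothesis.ValiantsHypothesis.Theorems.KPlusLogSqLawTropicalSymmetricThreeFourFifteenExclusion

/-!
# Route «KPlusLogSqLaw» — the SYMMETRIC `(3,4)` tropical row — the CARRIERS of Family A and its impossibility (`T_sym(3,4) ≤ 15`)
# (abstract, over terms of `S₃ × (Fin 3 → Fin 4)` with the pairwise exchange hypotheses and the sign rules)

HONEST FRAMING.  Helper file (seat val-sym-lift-p2 (g6), cell `pub-symmetroid`, 2026-08-27; `--supports` the `WeakLifting` item
stmt-ValiantsHypothesis-19561 as a helper, no closure claim).  A SMALL-FORMAT statement in the single-term-carrier model, far inside the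
known regime of the cruxes; nothing here is about `TropicalB` / `WeakLifting` in their windows, Conjecture B, the real census numeral of
Door A at `(3,4)` (`PosRootLawAt 3 4 18`, OPEN, never asserted), `MatrixDescartes` (stmt-ValiantsHypothesis-18050) or VP ≠ VNP.

THIS FILE («Family A» endgame).  Suppose a chain carries `{0,1,2} = D(u)`, `{0,2,3} = D(w)`, `{1,1,2}`, `{0,2,2}`, `{1,2,2}` and does NOT
carry `{0,0,3}`, `{0,1,3}` (the sign-free lemmas X/Y/W/V force exactly this, or its mirror image, on every 17-term chain).  Write `κ_c` for
the column where `u` has rank `c`.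
* `carriers`: the three crossing terms are forced: `{1,1,2} = T_{κ2}(2;1)`, `{0,2,2} = T_{κ0}(0;2)`, `{1,2,2} = T_{κ1}(1;2)` (fixed column /
  fixed rank / swapped rank), with `2·g 1 < g 0 + g 2` and `2·g 2 < g 0 + g 3` (single-entry exchange, crossing cancellation, fixed-entry
  monotonicity between terms on the same transposition);
* `familyA`: with `window` (`…FifteenExclusion`: the four terms `D(u), T_{κ2}(2;1), T_{κ0}(0;2), T_{κ1}(1;2)` are consecutive) and
  `parity` (`…FifteenLemmas`: their four signs cannot alternate), Family A is impossible for a sign-alternating chain. [cell statement R1668 «Lemma Z»; folklore-level exchange and sign arguments, no citation exists]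
-/

set_option linter.dupNamespace false
set_option autoImplicit false

namespace Summit.ValiantsHypothesis.ValiantsHypothesis.Theorems.KPlusLogSqLaw

open Summit.ValiantsHypothesis.ValiantsHypothesis.Theorems.MatrixDescartes.Negative
open Summit.ValiantsHypothesis.ValiantsHypothesis.Theorems.LacunarySymmetroidMatrixDescartes
open Summit.ValiantsHypothesis.ValiantsHypothesis.Theorems.LacunarySymmetroidMatrixDescartes.TropicalCensus
open Finset

namespace SymmetricThreeFourFifteen

open SymmetricThreeFour SymmetricThreeFourSeventeen SymmetricThreeFourSixteen

/-- class counts of the pattern vector `(0,2,2)`. -/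
theorem cnt022 : ∀ l : Fin 4, (univ.filter fun i : Fin 3 => (![0, 2, 2] : Fin 3 → Fin 4) i = l).card = (![1, 0, 2, 0] : Fin 4 → ℕ) l := by
  decide

/-- **Carriers in Family A.**  If `{0,1,2} = D(u)` (index `a₀`), `{0,2,3}` (index `b`), `{1,1,2}` (`c`), `{0,2,2}` (`f`), `{1,2,2}` (`e`)
are all carried, then with `κ_c` the column where `u` has rank `c`: the `{1,1,2}` term is a crossing term fixing `κ2` with rank `2` there,
the `{0,2,2}` term fixes `κ0` with rank `0`, the `{1,2,2}` term fixes `κ1` with rank `1`; moreover `2·g 1 < g 0 + g 2` and `2·g 2 < g 0 + g 3`.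
[exchange argument] -/
theorem carriers {n : ℕ} (r : Fin (n + 1) → Equiv.Perm (Fin 3) × (Fin 3 → Fin 4)) (g : Fin 4 → ℕ)
    (h1 : ∀ k i, (r k).2 ((r k).1 i) = (r k).2 i)
    (h2 : ∀ a b : Fin (n + 1), a < b → ∀ i, (r a).1 i = (r b).1 i → (r a).2 i ≤ (r b).2 i)
    (h6 : ∀ a b : Fin (n + 1), a < b → (r a).1 = 1 → ∀ i j : Fin 3, i ≠ j → (r b).1 i = j → (r b).1 j = i →
      g ((r a).2 i) + g ((r a).2 j) < 2 * g ((r b).2 i))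
    (h7 : ∀ a b : Fin (n + 1), a < b → (r b).1 = 1 → ∀ i j : Fin 3, i ≠ j → (r a).1 i = j → (r a).1 j = i →
      2 * g ((r a).2 i) < g ((r b).2 i) + g ((r b).2 j))
    (h8 : ∀ (a b : Fin (n + 1)) (i j : Fin 3), (r a).2 i ≤ (r b).2 j → g ((r a).2 i) ≤ g ((r b).2 j)) (a₀ b c f e : Fin (n + 1))
    (ha : TropicalCensus.classSym (r a₀) = TropicalCensus.classSym ((1 : Equiv.Perm (Fin 3)), (![0, 1, 2] : Fin 3 → Fin 4)))
    (hb : TropicalCensus.classSym (r b) = TropicalCensus.classSym ((1 : Equiv.Perm (Fin 3)), (![0, 2, 3] : Fin 3 → Fin 4)))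
    (hc : TropicalCensus.classSym (r c) = TropicalCensus.classSym ((1 : Equiv.Perm (Fin 3)), (![1, 1, 2] : Fin 3 → Fin 4)))
    (hf : TropicalCensus.classSym (r f) = TropicalCensus.classSym ((1 : Equiv.Perm (Fin 3)), (![0, 2, 2] : Fin 3 → Fin 4)))
    (he : TropicalCensus.classSym (r e) = TropicalCensus.classSym ((1 : Equiv.Perm (Fin 3)), (![1, 2, 2] : Fin 3 → Fin 4))) :
    (r a₀).1 = 1 ∧ 2 * g 1 < g 0 + g 2 ∧ 2 * g 2 < g 0 + g 3 ∧
    ∃ κ0 κ1 κ2 : Fin 3, κ0 ≠ κ1 ∧ κ0 ≠ κ2 ∧ κ1 ≠ κ2 ∧ (r a₀).2 κ0 = 0 ∧ (r a₀).2 κ1 = 1 ∧ (r a₀).2 κ2 = 2 ∧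
      ((r c).1 ≠ 1 ∧ (r c).1 κ2 = κ2 ∧ (r c).2 κ2 = 2) ∧
      ((r f).1 ≠ 1 ∧ (r f).1 κ0 = κ0 ∧ (r f).2 κ0 = 0) ∧
      ((r e).1 ≠ 1 ∧ (r e).1 κ1 = κ1 ∧ (r e).2 κ1 = 1) := by
  have ca : ∀ l, (univ.filter fun i => (r a₀).2 i = l).card = (![1, 1, 1, 0] : Fin 4 → ℕ) l :=
    fun l => (card_filter_eq_of_classSym_eq ha l).trans (cnt012 l)
  have cb : ∀ l, (univ.filter fun i => (r b).2 i = l).card = (![1, 0, 1, 1] : Fin 4 → ℕ) l :=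
    fun l => (card_filter_eq_of_classSym_eq hb l).trans (cnt023 l)
  have cc : ∀ l, (univ.filter fun i => (r c).2 i = l).card = (![0, 2, 1, 0] : Fin 4 → ℕ) l :=
    fun l => (card_filter_eq_of_classSym_eq hc l).trans (cnt112 l)
  have cf : ∀ l, (univ.filter fun i => (r f).2 i = l).card = (![1, 0, 2, 0] : Fin 4 → ℕ) l :=
    fun l => (card_filter_eq_of_classSym_eq hf l).trans (cnt022 l)
  have ce : ∀ l, (univ.filter fun i => (r e).2 i = l).card = (![0, 1, 2, 0] : Fin 4 → ℕ) l :=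
    fun l => (card_filter_eq_of_classSym_eq he l).trans (cnt122 l)
  have hg23 : 2 * g 2 < g 0 + g 3 := lemmaY2 r g h1 h2 h6 h7 h8 b e hb he
  -- `D(u)`, its columns `κ0, κ1, κ2`
  have ha1 : (r a₀).1 = 1 := perm_eq_one_of_card_le_one _ (h1 a₀) fun l => by
    rw [ca l]; fin_cases l <;> decide
  obtain ⟨κ0, hκ0⟩ := exists_of_card_pos ((r a₀).2) 0 (by rw [ca 0]; decide)
  obtain ⟨κ1, hκ1⟩ := exists_of_card_pos ((r a₀).2) 1 (by rw [ca 1]; decide)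
  obtain ⟨κ2, hκ2⟩ := exists_of_card_pos ((r a₀).2) 2 (by rw [ca 2]; decide)
  have hκ01 : κ0 ≠ κ1 := by rintro rfl; rw [hκ0] at hκ1; exact absurd hκ1 (by decide)
  have hκ02 : κ0 ≠ κ2 := by rintro rfl; rw [hκ0] at hκ2; exact absurd hκ2 (by decide)
  have hκ12 : κ1 ≠ κ2 := by rintro rfl; rw [hκ1] at hκ2; exact absurd hκ2 (by decide)
  have ua3 : ∀ i, (r a₀).2 i ≠ 3 := ne_of_card_zero _ 3 (by rw [ca 3]; rfl)
  have u0 : ∀ i, i ≠ κ0 → (r a₀).2 i ≠ 0 := fun i hi => ne_of_card_one _ 0 (by rw [ca 0]; rfl) hκ0 hi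
  have u1 : ∀ i, i ≠ κ1 → (r a₀).2 i ≠ 1 := fun i hi => ne_of_card_one _ 1 (by rw [ca 1]; rfl) hκ1 hi
  have u2 : ∀ i, i ≠ κ2 → (r a₀).2 i ≠ 2 := fun i hi => ne_of_card_one _ 2 (by rw [ca 2]; rfl) hκ2 hi
  -- `D(w)`: `a₀ < b`, `u ≤ w`, `w κ0 = 0`
  have hb1 : (r b).1 = 1 := perm_eq_one_of_card_le_one _ (h1 b) fun l => by
    rw [cb l]; fin_cases l <;> decide
  obtain ⟨k3, hk3⟩ := exists_of_card_pos ((r b).2) 3 (by rw [cb 3]; decide)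
  have wb1 : ∀ i, (r b).2 i ≠ 1 := ne_of_card_zero _ 1 (by rw [cb 1]; rfl)
  have hab : a₀ < b := by
    have hne : a₀ ≠ b := by
      intro hq; have := ca 1; rw [hq, cb 1] at this; exact absurd this (by decide)
    rcases lt_or_gt_of_ne hne with hlt | hlt
    · exact hlt
    · exfalso
      have hle := h2 b a₀ hlt k3 (by rw [ha1, hb1])
      rw [hk3] at hle
      exact ua3 k3 (le_antisymm (Fin.le_last _) hle)
  have huw : ∀ i, (r a₀).2 i ≤ (r b).2 i := fun i => h2 a₀ b hab i (by rw [ha1, hb1])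
  have hw0 : (r b).2 κ0 = 0 := by
    obtain ⟨q, hq⟩ := exists_of_card_pos ((r b).2) 0 (by rw [cb 0]; decide)
    have hle := huw q
    rw [hq] at hle
    have : q = κ0 := by
      by_contra hne
      exact u0 q hne (le_antisymm hle (Fin.zero_le _))
    rw [← this]; exact hq
  have w0 : ∀ i, i ≠ κ0 → (r b).2 i ≠ 0 := fun i hi => ne_of_card_one _ 0 (by rw [cb 0]; rfl) hw0 hi
  -- `{1,2,2}`: a crossing term fixing `κ1`, before `D(w)`; `w κ2 = 3`, `w κ1 = 2`
  have hbe : b ≠ e := by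
    intro hq; have := cb 0; rw [hq, ce 0] at this; exact absurd this (by decide)
  have hae' : a₀ ≠ e := by
    intro hq; have := ca 0; rw [hq, ce 0] at this; exact absurd this (by decide)
  have ve3 : ∀ i, (r e).2 i ≠ 3 := ne_of_card_zero _ 3 (by rw [ce 3]; rfl)
  have ve0 : ∀ i, (r e).2 i ≠ 0 := ne_of_card_zero _ 0 (by rw [ce 0]; rfl)
  have he1 : (r e).1 ≠ 1 := by
    intro hq
    rcases lt_or_gt_of_ne hbe with hlt | hlt
    · have hle := h2 b e hlt k3 (by rw [hb1, hq])
      rw [hk3] at hle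
      exact ve3 k3 (le_antisymm (Fin.le_last _) hle)
    · have hle := h2 e b hlt κ0 (by rw [hb1, hq])
      rw [hw0] at hle
      exact ve0 κ0 (le_antisymm hle (Fin.zero_le _))
  obtain ⟨hmovE, hfixE, γ, hγ⟩ := transposition_served (r e) 2 1 (h1 e) he1 (by rw [ce 1]; rfl)
    (fun l hl => by rw [ce l]; fin_cases l <;> first | decide | exact absurd rfl hl)
  obtain ⟨i₂, j₂, hij₂, hi₂, hj₂, hi₂γ, hj₂γ⟩ := moved_pair (r e).1 γ he1 hγ
  have hei₂ : (r e).2 i₂ = 2 := hmovE i₂ (by rw [hi₂]; exact hij₂.symm)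
  have hej₂ : (r e).2 j₂ = 2 := hmovE j₂ (by rw [hj₂]; exact hij₂)
  have heγ : (r e).2 γ = 1 := hfixE γ hγ
  have hae : a₀ < e := by
    rcases lt_or_gt_of_ne hae' with hlt | hlt
    · exact hlt
    · exfalso
      have hC := h7 e a₀ hlt ha1 i₂ j₂ hij₂ hi₂ hj₂
      rw [hei₂] at hC
      have gi := h8 a₀ e i₂ i₂ (by rw [hei₂]; exact f4_i _ (ua3 i₂))
      have gj := h8 a₀ e j₂ j₂ (by rw [hej₂]; exact f4_i _ (ua3 j₂))
      rw [hei₂] at gi; rw [hej₂] at gj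
      omega
  have hγ2 : γ ≠ κ2 := by
    intro hq
    have hle := h2 a₀ e hae γ (by rw [ha1, hγ, Equiv.Perm.one_apply])
    rw [heγ, hq, hκ2] at hle
    exact absurd hle (by decide)
  have heb : e < b := by
    rcases lt_or_gt_of_ne hbe with hlt | hlt
    · exfalso
      have hle := h2 b e hlt γ (by rw [hb1, hγ, Equiv.Perm.one_apply])
      rw [heγ] at hle
      have hγ0 : γ = κ0 := by
        by_contra hne
        exact w0 γ hne (f4_f _ hle (wb1 γ))
      have hC := h6 b e hlt hb1 i₂ j₂ hij₂ hi₂ hj₂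
      rw [hei₂] at hC
      have hwi : (r b).2 i₂ ≠ 0 := w0 i₂ (by rw [← hγ0]; exact hi₂γ)
      have hwj : (r b).2 j₂ ≠ 0 := w0 j₂ (by rw [← hγ0]; exact hj₂γ)
      have gi := h8 e b i₂ i₂ (by rw [hei₂]; exact f4_g _ hwi (wb1 i₂))
      have gj := h8 e b j₂ j₂ (by rw [hej₂]; exact f4_g _ hwj (wb1 j₂))
      rw [hei₂] at gi; rw [hej₂] at gj
      omega
    · exact hlt
  have hγ0 : γ ≠ κ0 := by
    intro hq
    have hle := h2 e b heb γ (by rw [hb1, hγ, Equiv.Perm.one_apply])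
    rw [heγ, hq, hw0] at hle
    exact absurd hle (by decide)
  have hγ1 : γ = κ1 := by
    rcases eq_or_eq_of_ne_third κ1 κ2 κ0 γ hκ12 hκ01.symm hκ02.symm hγ0 with hq | hq
    · exact hq
    · exact absurd hq hγ2
  -- the swapped pair of the `{1,2,2}` term is `{κ0, κ2}`; cancellation gives `w κ2 = 3`
  have hw23 : (r b).2 κ2 = 3 := by
    have hC := h7 e b heb hb1 i₂ j₂ hij₂ hi₂ hj₂
    rw [hei₂] at hC
    have hpair : ∀ x, x ≠ γ → x = κ0 ∨ x = κ2 := fun x hx =>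
      eq_or_eq_of_ne_third κ0 κ2 κ1 x hκ02 hκ01 hκ12.symm (by rw [← hγ1]; exact hx)
    -- whichever of `i₂, j₂` is `κ2`: if `w κ2 = 2` the cancellation reads `2 g 2 < g 0 + g 2`
    by_contra hne
    have hw2le : (r b).2 κ2 ≤ 2 := f4_i _ hne
    have hw2ge : 2 ≤ (r b).2 κ2 := by have := huw κ2; rwa [hκ2] at this
    have hw22 : (r b).2 κ2 = 2 := le_antisymm hw2le hw2ge
    have g2 : ∀ x, x ≠ γ → g ((r b).2 x) ≤ g 2 := by
      intro x hx
      rcases hpair x hx with hq | hq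
      · rw [hq, hw0]; have := h8 a₀ a₀ κ0 κ2 (by rw [hκ0, hκ2]; decide); rwa [hκ0, hκ2] at this
      · rw [hq, hw22]
    have g0i : g ((r b).2 i₂) + g ((r b).2 j₂) ≤ g 0 + g 2 := by
      rcases hpair i₂ hi₂γ with hq | hq
      · have hj : j₂ = κ2 := by
          rcases hpair j₂ hj₂γ with hq' | hq'
          · exact absurd (hq.trans hq'.symm) hij₂
          · exact hq'
        rw [hq, hj, hw0, hw22]
      · have hj : j₂ = κ0 := by
          rcases hpair j₂ hj₂γ with hq' | hq'
          · exact hq'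
          · exact absurd (hq.trans hq'.symm) hij₂
        rw [hq, hj, hw0, hw22]; omega
    have g02 : g 0 ≤ g 2 := by
      have := h8 a₀ a₀ κ0 κ2 (by rw [hκ0, hκ2]; decide); rwa [hκ0, hκ2] at this
    omega
  have hw12 : (r b).2 κ1 = 2 := by
    obtain ⟨q, hq⟩ := exists_of_card_pos ((r b).2) 2 (by rw [cb 2]; decide)
    have hq0 : q ≠ κ0 := by rintro rfl; rw [hw0] at hq; exact absurd hq (by decide)
    have hq2 : q ≠ κ2 := by rintro rfl; rw [hw23] at hq; exact absurd hq (by decide)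
    rcases eq_or_eq_of_ne_third κ1 κ2 κ0 q hκ12 hκ01.symm hκ02.symm hq0 with h' | h'
    · rw [← h']; exact hq
    · exact absurd h' hq2
  -- `{0,2,2}`: a crossing term fixing `κ0`
  have hfe : f ≠ e := by
    intro hq; have := cf 0; rw [hq, ce 0] at this; exact absurd this (by decide)
  have haf' : a₀ ≠ f := by
    intro hq; have := ca 1; rw [hq, cf 1] at this; exact absurd this (by decide)
  have vf1 : ∀ i, (r f).2 i ≠ 1 := ne_of_card_zero _ 1 (by rw [cf 1]; rfl)
  have vf3 : ∀ i, (r f).2 i ≠ 3 := ne_of_card_zero _ 3 (by rw [cf 3]; rfl)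
  have hf1 : (r f).1 ≠ 1 := by
    intro hq
    rcases lt_or_gt_of_ne hfe with hlt | hlt
    · have hle := h2 f e hlt κ1 (by rw [hq, ← hγ1, hγ, Equiv.Perm.one_apply])
      rw [← hγ1, heγ] at hle
      have hv0 : (r f).2 γ = 0 := f4_f _ hle (vf1 γ)
      rcases lt_or_gt_of_ne haf' with hlt' | hlt'
      · have hle' := h2 a₀ f hlt' γ (by rw [ha1, hq])
        rw [hγ1, hκ1, ← hγ1, hv0] at hle'
        exact absurd hle' (by decide)
      · obtain ⟨p, q, hpq, hp, hq'⟩ := exists_pair_of_card_two ((r f).2) 2 (cf 2)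
        have hp2 : (r a₀).2 p = 2 := by
          have hle' := h2 f a₀ hlt' p (by rw [ha1, hq])
          rw [hp] at hle'
          exact le_antisymm (f4_i _ (ua3 p)) hle'
        have hq2 : (r a₀).2 q = 2 := by
          have hle' := h2 f a₀ hlt' q (by rw [ha1, hq])
          rw [hq'] at hle'
          exact le_antisymm (f4_i _ (ua3 q)) hle'
        have h2le := two_le_card_filter (r a₀) hpq (hp2.trans hq2.symm)
        rw [hq2, ca 2] at h2le
        exact absurd h2le (by decide)
    · have hC := h7 e f hlt hq i₂ j₂ hij₂ hi₂ hj₂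
      rw [hei₂] at hC
      have gi := h8 f e i₂ i₂ (by rw [hei₂]; exact f4_i _ (vf3 i₂))
      have gj := h8 f e j₂ j₂ (by rw [hej₂]; exact f4_i _ (vf3 j₂))
      rw [hei₂] at gi; rw [hej₂] at gj
      omega
  obtain ⟨hmovF, hfixF, φ, hφ⟩ := transposition_served (r f) 2 0 (h1 f) hf1 (by rw [cf 0]; rfl)
    (fun l hl => by rw [cf l]; fin_cases l <;> first | decide | exact absurd rfl hl)
  obtain ⟨i₄, j₄, hij₄, hi₄, hj₄, -, -⟩ := moved_pair (r f).1 φ hf1 hφ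
  have hfi₄ : (r f).2 i₄ = 2 := hmovF i₄ (by rw [hi₄]; exact hij₄.symm)
  have hfj₄ : (r f).2 j₄ = 2 := hmovF j₄ (by rw [hj₄]; exact hij₄)
  have hfφ : (r f).2 φ = 0 := hfixF φ hφ
  have haf : a₀ < f := by
    rcases lt_or_gt_of_ne haf' with hlt | hlt
    · exact hlt
    · exfalso
      have hC := h7 f a₀ hlt ha1 i₄ j₄ hij₄ hi₄ hj₄
      rw [hfi₄] at hC
      have gi := h8 a₀ f i₄ i₄ (by rw [hfi₄]; exact f4_i _ (ua3 i₄))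
      have gj := h8 a₀ f j₄ j₄ (by rw [hfj₄]; exact f4_i _ (ua3 j₄))
      rw [hfi₄] at gi; rw [hfj₄] at gj
      omega
  have hφ0 : φ = κ0 := by
    by_contra hne
    have hle := h2 a₀ f haf φ (by rw [ha1, hφ, Equiv.Perm.one_apply])
    rw [hfφ] at hle
    exact u0 φ hne (le_antisymm hle (Fin.zero_le _))
  -- `{1,1,2}`: a crossing term fixing `κ2`; `2 g 1 < g 0 + g 2`
  have hbc : b ≠ c := by
    intro hq; have := cb 0; rw [hq, cc 0] at this; exact absurd this (by decide)
  have hac' : a₀ ≠ c := by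
    intro hq; have := ca 0; rw [hq, cc 0] at this; exact absurd this (by decide)
  have hce : c ≠ e := by
    intro hq; have := cc 1; rw [hq, ce 1] at this; exact absurd this (by decide)
  have vc3 : ∀ i, (r c).2 i ≠ 3 := ne_of_card_zero _ 3 (by rw [cc 3]; rfl)
  have vc0 : ∀ i, (r c).2 i ≠ 0 := ne_of_card_zero _ 0 (by rw [cc 0]; rfl)
  have hc1 : (r c).1 ≠ 1 := by
    intro hq
    rcases lt_or_gt_of_ne hbc with hlt | hlt
    · have hle := h2 b c hlt k3 (by rw [hb1, hq])
      rw [hk3] at hle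
      exact vc3 k3 (le_antisymm (Fin.le_last _) hle)
    · have hle := h2 c b hlt κ0 (by rw [hb1, hq])
      rw [hw0] at hle
      exact vc0 κ0 (le_antisymm hle (Fin.zero_le _))
  obtain ⟨hmovC, hfixC, β, hβ⟩ := transposition_served (r c) 1 2 (h1 c) hc1 (by rw [cc 2]; rfl)
    (fun l hl => by rw [cc l]; fin_cases l <;> first | decide | exact absurd rfl hl)
  obtain ⟨i₁, j₁, hij₁, hi₁, hj₁, hi₁β, hj₁β⟩ := moved_pair (r c).1 β hc1 hβ
  have hci₁ : (r c).2 i₁ = 1 := hmovC i₁ (by rw [hi₁]; exact hij₁.symm)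
  have hcj₁ : (r c).2 j₁ = 1 := hmovC j₁ (by rw [hj₁]; exact hij₁)
  have hcβ : (r c).2 β = 2 := hfixC β hβ
  have hβ1 : β ≠ κ1 := by
    intro hq
    have hperm : (r c).1 = (r e).1 := perm_three_eq_of_fixed _ _ hc1 he1 β hβ (by rw [hq, ← hγ1, hγ])
    rcases lt_or_gt_of_ne hce with hlt | hlt
    · have hle := h2 c e hlt β (by rw [hperm])
      rw [hcβ, hq, ← hγ1, heγ] at hle
      exact absurd hle (by decide)
    · have hle := h2 e c hlt i₂ (by rw [hperm])
      rw [hei₂, hmovC i₂ (by rw [hperm, hi₂]; exact hij₂.symm)] at hle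
      exact absurd hle (by decide)
  have hac : a₀ < c := by
    rcases lt_or_gt_of_ne hac' with hlt | hlt
    · exact hlt
    · exfalso
      have hle := h2 c a₀ hlt β (by rw [ha1, hβ, Equiv.Perm.one_apply])
      rw [hcβ] at hle
      have hβ2 : β = κ2 := by
        by_contra hne
        exact u2 β hne (le_antisymm (f4_i _ (ua3 β)) hle)
      have hC := h7 c a₀ hlt ha1 i₁ j₁ hij₁ hi₁ hj₁
      rw [hci₁] at hC
      have hui : (r a₀).2 i₁ ≤ 1 := f4_e _ (ua3 i₁) (u2 i₁ (by rw [← hβ2]; exact hi₁β))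
      have huj : (r a₀).2 j₁ ≤ 1 := f4_e _ (ua3 j₁) (u2 j₁ (by rw [← hβ2]; exact hj₁β))
      have gi := h8 a₀ c i₁ i₁ (by rw [hci₁]; exact hui)
      have gj := h8 a₀ c j₁ j₁ (by rw [hcj₁]; exact huj)
      rw [hci₁] at gi; rw [hcj₁] at gj
      omega
  have hβ0 : β ≠ κ0 := by
    intro hq
    have hC := h6 a₀ c hac ha1 i₁ j₁ hij₁ hi₁ hj₁
    rw [hci₁] at hC
    have hui : 1 ≤ (r a₀).2 i₁ := f4_b _ (u0 i₁ (by rw [← hq]; exact hi₁β))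
    have huj : 1 ≤ (r a₀).2 j₁ := f4_b _ (u0 j₁ (by rw [← hq]; exact hj₁β))
    have gi := h8 c a₀ i₁ i₁ (by rw [hci₁]; exact hui)
    have gj := h8 c a₀ j₁ j₁ (by rw [hcj₁]; exact huj)
    rw [hci₁] at gi; rw [hcj₁] at gj
    omega
  have hβ2 : β = κ2 := by
    rcases eq_or_eq_of_ne_third κ1 κ2 κ0 β hκ12 hκ01.symm hκ02.symm hβ0 with hq | hq
    · exact absurd hq hβ1
    · exact hq
  have hcb : c < b := by
    rcases lt_or_gt_of_ne hbc with hlt | hlt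
    · exfalso
      have hle := h2 b c hlt β (by rw [hb1, hβ, Equiv.Perm.one_apply])
      rw [hcβ, hβ2, hw23] at hle
      exact absurd hle (by decide)
    · exact hlt
  have hg12 : 2 * g 1 < g 0 + g 2 := by
    have hC := h7 c b hcb hb1 i₁ j₁ hij₁ hi₁ hj₁
    rw [hci₁] at hC
    have hpair : ∀ x, x ≠ β → x = κ0 ∨ x = κ1 := fun x hx =>
      eq_or_eq_of_ne_third κ0 κ1 κ2 x hκ01 hκ02 hκ12 (by rw [← hβ2]; exact hx)
    rcases hpair i₁ hi₁β with hq | hq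
    · have hj : j₁ = κ1 := by
        rcases hpair j₁ hj₁β with hq' | hq'
        · exact absurd (hq.trans hq'.symm) hij₁
        · exact hq'
      rw [hq, hj, hw0, hw12] at hC; omega
    · have hj : j₁ = κ0 := by
        rcases hpair j₁ hj₁β with hq' | hq'
        · exact hq'
        · exact absurd (hq.trans hq'.symm) hij₁
      rw [hq, hj, hw0, hw12] at hC; omega
  refine ⟨ha1, hg12, hg23, κ0, κ1, κ2, hκ01, hκ02, hκ12, hκ0, hκ1, hκ2, ⟨hc1, ?_, ?_⟩, ⟨hf1, ?_, ?_⟩, ⟨he1, ?_, ?_⟩⟩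
  · rw [← hβ2]; exact hβ
  · rw [← hβ2]; exact hcβ
  · rw [← hφ0]; exact hφ
  · rw [← hφ0]; exact hfφ
  · rw [← hγ1]; exact hγ
  · rw [← hγ1]; exact heγ

/-- **Family A is impossible with signs.**  A chain (terms `r`, rank exponents `g` monotone, slopes strictly increasing, exchange rules
`h2`/`h6`/`h7`, sign data `s`, `A` with `hD`/`hT` and alternation `halt`) cannot carry `{0,1,2}, {0,2,3}, {1,1,2}, {0,2,2}, {1,2,2}` while
missing `{0,0,3}` and `{0,1,3}`. [`carriers` + `window` + `parity`] -/
theorem familyA {n : ℕ} (r : Fin (n + 1) → Equiv.Perm (Fin 3) × (Fin 3 → Fin 4)) (g : Fin 4 → ℕ) (hmono : Monotone g)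
    (s : Fin (n + 1) → ℤ) (A : Fin 3 → Fin 4 → ℤ)
    (h1 : ∀ k i, (r k).2 ((r k).1 i) = (r k).2 i)
    (h2 : ∀ a b : Fin (n + 1), a < b → ∀ i, (r a).1 i = (r b).1 i → (r a).2 i ≤ (r b).2 i)
    (h3 : Function.Injective fun k => TropicalCensus.classSym (r k))
    (hS : ∀ a b : Fin (n + 1), a < b → TropicalCensus.slope g (r a) < TropicalCensus.slope g (r b))
    (h6 : ∀ a b : Fin (n + 1), a < b → (r a).1 = 1 → ∀ i j : Fin 3, i ≠ j → (r b).1 i = j → (r b).1 j = i →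
      g ((r a).2 i) + g ((r a).2 j) < 2 * g ((r b).2 i))
    (h7 : ∀ a b : Fin (n + 1), a < b → (r b).1 = 1 → ∀ i j : Fin 3, i ≠ j → (r a).1 i = j → (r a).1 j = i →
      2 * g ((r a).2 i) < g ((r b).2 i) + g ((r b).2 j))
    (hD : ∀ a, (r a).1 = 1 → s a = ∏ k, A k ((r a).2 k))
    (hT : ∀ (a : Fin (n + 1)) (k : Fin 3), (r a).1 ≠ 1 → (r a).1 k = k → ∀ t : ℤ, s a * t < 0 ↔ -A k ((r a).2 k) * t < 0)
    (halt : ∀ k : Fin n, s k.castSucc * s k.succ < 0) (a₀ b c f e : Fin (n + 1))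
    (ha : TropicalCensus.classSym (r a₀) = TropicalCensus.classSym ((1 : Equiv.Perm (Fin 3)), (![0, 1, 2] : Fin 3 → Fin 4)))
    (hb : TropicalCensus.classSym (r b) = TropicalCensus.classSym ((1 : Equiv.Perm (Fin 3)), (![0, 2, 3] : Fin 3 → Fin 4)))
    (hc : TropicalCensus.classSym (r c) = TropicalCensus.classSym ((1 : Equiv.Perm (Fin 3)), (![1, 1, 2] : Fin 3 → Fin 4)))
    (hf : TropicalCensus.classSym (r f) = TropicalCensus.classSym ((1 : Equiv.Perm (Fin 3)), (![0, 2, 2] : Fin 3 → Fin 4)))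
    (he : TropicalCensus.classSym (r e) = TropicalCensus.classSym ((1 : Equiv.Perm (Fin 3)), (![1, 2, 2] : Fin 3 → Fin 4)))
    (hno003 : ∀ k, TropicalCensus.classSym (r k) ≠ TropicalCensus.classSym ((1 : Equiv.Perm (Fin 3)), (![0, 0, 3] : Fin 3 → Fin 4)))
    (hno013 : ∀ k, TropicalCensus.classSym (r k) ≠ TropicalCensus.classSym ((1 : Equiv.Perm (Fin 3)), (![0, 1, 3] : Fin 3 → Fin 4))) :
    False := by
  have h8 : ∀ (a b : Fin (n + 1)) (i j : Fin 3), (r a).2 i ≤ (r b).2 j → g ((r a).2 i) ≤ g ((r b).2 j) :=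
    fun a b i j h => hmono h
  obtain ⟨ha1, hg12, hg23, κ0, κ1, κ2, hκ01, hκ02, hκ12, hu0, hu1, hu2, ⟨hc1, hcκ, hc2⟩, ⟨hf1, hfκ, hf2⟩, ⟨he1, heκ, he2⟩⟩ :=
    carriers r g h1 h2 h6 h7 h8 a₀ b c f e ha hb hc hf he
  obtain ⟨hcv, hfv, hev⟩ := window r g hmono h3 hS hg12 hg23 a₀ c f e ha hc hf he hno003 hno013
  exact parity r s A hD hT halt a₀ c f e hcv hfv hev ha1 κ0 κ1 κ2 hκ01 hκ02 hκ12
    ⟨hc1, hcκ, by rw [hc2, hu2]⟩ ⟨hf1, hfκ, by rw [hf2, hu0]⟩ ⟨he1, heκ, by rw [he2, hu1]⟩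

end SymmetricThreeFourFifteen

end Summit.ValiantsHypothesis.ValiantsHypothesis.Theorems.KPlusLogSqLaw
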